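import Literature.Analysis.FluidPDE.LocalTypeI
import Literature.Analysis.FluidPDE.SpaceTimeRescaling
import HarnessLib

/-!
# Navier–Stokes scaling of the Albritton–Barker Type I quantity

Trunk T-FLUID (`Literature/Analysis/FluidPDE`), family NS; proofs layer over
`Literature/Analysis/FluidPDE/LocalTypeI.lean` (Albritton–Barker 2019, Thm 1.1, corrected
rendering `Literature.Analysis.FluidPDE.AlbrittonBarkerTypeICharacterization`).

Both directions of Albritton–Barker's proof of Thm 1.1 (§3) rescale: "By translating in
space-time and rescaling" (the blow-down `v^{(k)}(x, t) = k v(k x, k² t)` of the ancient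
solution in the reverse direction; the Seregin–Šverák zoom-in in the forward direction), using
tacitly that the quantities `A, C, D, E` of §1 and hence `𝐈(ω)` are invariant under the
Navier–Stokes scaling `v ↦ c v(t₀ + c² s, x₀ + c y)`, `q ↦ c² q(t₀ + c² s, x₀ + c y)` composed
with the corresponding map of parabolic balls `Q(z, r) ↦ Q(Φ z, c r)`,
`Φ = Fluid.stAffine (c²) c t₀ x₀`. This file proves these invariances for the printed
(`ℝ≥0∞`-valued) renderings `NS.cknAEss`, `Fluid.cknC`, `NS.cknDOsc`, `Fluid.cknE`,
`NS.abScaledSum`, `NS.typeIBound` of `LocalTypeI.lean`, with the zoomed fields written in the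
accepted vocabulary `c • Fluid.stPull (c²) c t₀ x₀ u` (`SpaceTimeRescaling.lean`,
Escauriaza–Seregin–Šverák 2003, §3):

* `cknC_nsZoom`, `cknE_nsZoom`, `cknAEss_nsZoom`, `cknDOsc_nsZoom`, `abScaledSum_nsZoom`:
  `X(v_c, q_c; Q(z, r)) = X(v, q; Q(Φ z, c r))` for `c, r > 0`;
* `typeIBound_nsZoom`: `𝐈(Φ⁻¹ ω; v_c, q_c) = 𝐈(ω; v, q)`; in particular `𝐈 = 𝐈(ℝ³ × ℝ₋)` is
  invariant under zooming about the origin (`typeIBound_lowerHalf_nsZoom`), and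
  `Φ⁻¹ Q(0, R) = Q(0, R/c)` (`stAffine_preimage_parabolicCylinder_zero`);
* `eLpNorm_top_nsZoom`: `‖v_c‖_{L^∞(Q(z, r))} = c ‖v‖_{L^∞(Q(Φ z, c r))}` (the identity
  `‖v^{(k)}‖_{L^∞(Q(1/k))} = k N` of A–B §3);
* tools: preimages of parabolic balls and balls under the zoom, transport of essential suprema
  along the time-affine map (`essSup_comp_time_affine`), zoom invariance of ball averages
  (`setAverage_ball_comp_space_affine`); `Fluid.frobeniusNormSq_smul` (accepted).

All statements are exact identities in `ℝ≥0∞`; the hypotheses `0 < c`, `0 < r` exclude the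
documented junk values of the quantities at `r ≤ 0`.

## References

* D. Albritton, T. Barker, *On local Type I singularities of the Navier–Stokes equations and
  Liouville theorems*, J. Math. Fluid Mech. 21 (2019), no. 3, arXiv:1811.00502, §1 and §3.
* L. Escauriaza, G. Seregin, V. Šverák, *`L_{3,∞}`-solutions of Navier–Stokes equations and
  backward uniqueness*, Russian Math. Surveys 58 (2003), §3 (parabolic scaling).
-/

noncomputable section

open MeasureTheory Set Function Filter Topology TopologicalSpace Metric
open scoped NNReal ENNReal InnerProductSpace RealInnerProductSpace

namespace Literature.Analysis.FluidPDE

/-- Local notation for physical space `ℝ³ = EuclideanSpace ℝ (Fin 3)`. -/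
local notation "ℝ³" => EuclideanSpace ℝ (Fin 3)

/-! ## Navier–Stokes scaling of the A–B quantities -/

section Scaling


variable {c t₀ r : ℝ} {x₀ : ℝ³}

/-- The zoom maps the parabolic ball `Q(z, r)` onto `Q(Φ z, c r)`: preimage form. [folklore] -/
theorem LocalTypeIScaling.stAffine_preimage_parabolicCylinder (hc : 0 < c) (t₀ : ℝ) (x₀ : ℝ³) (r : ℝ) (z : ℝ × ℝ³) :
    stAffine (c ^ 2) c t₀ x₀ ⁻¹' parabolicCylinder (c * r) (stAffine (c ^ 2) c t₀ x₀ z) =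
      parabolicCylinder r z := by
  have hc2 : 0 < c ^ 2 := by positivity
  rw [parabolicCylinder, stAffine_fst, stAffine_snd, stAffine_preimage_cylinder hc2 hc,
    parabolicCylinder]
  congr 1
  · congr 1
    · field_simp
      ring
    · field_simp
      ring
  · congr 1
    · rw [add_sub_cancel_left, smul_smul, inv_mul_cancel₀ hc.ne', one_smul]
    · field_simp

/-- Bookkeeping of the scaling constants for `C` and `D` (`r⁻²`-normalised, integrand of
weight `c³`): `r⁻² · (c² c³)⁻¹ · c³ = (c r)⁻²` in `ℝ≥0∞`. [folklore] -/
theorem scaleConst_sq (hc : 0 < c) (hr : 0 < r) :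
    (ENNReal.ofReal r ^ 2)⁻¹ * (ENNReal.ofReal (c ^ 2 * c ^ 3)⁻¹ * ENNReal.ofReal c ^ 3) =
      (ENNReal.ofReal (c * r) ^ 2)⁻¹ := by
  rw [← ENNReal.ofReal_pow hc.le, ← ENNReal.ofReal_pow hr.le,
    ← ENNReal.ofReal_pow (by positivity : 0 ≤ c * r),
    ← ENNReal.ofReal_inv_of_pos (by positivity : (0:ℝ) < r ^ 2),
    ← ENNReal.ofReal_inv_of_pos (by positivity : (0:ℝ) < (c * r) ^ 2),
    ← ENNReal.ofReal_mul (by positivity), ← ENNReal.ofReal_mul (by positivity)]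
  congr 1
  field_simp

/-- Bookkeeping of the scaling constants for `A` and `E` (`r⁻¹`-normalised): with spatial
weight `(c³)⁻¹ c²` resp. space–time weight `(c² c³)⁻¹ c⁴`. [folklore] -/
theorem scaleConst_one (hc : 0 < c) (hr : 0 < r) :
    (ENNReal.ofReal r)⁻¹ * (ENNReal.ofReal (c ^ 3)⁻¹ * ENNReal.ofReal c ^ 2) =
      (ENNReal.ofReal (c * r))⁻¹ := by
  rw [← ENNReal.ofReal_pow hc.le,
    ← ENNReal.ofReal_inv_of_pos hr, ← ENNReal.ofReal_inv_of_pos (by positivity : (0:ℝ) < c * r),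
    ← ENNReal.ofReal_mul (by positivity), ← ENNReal.ofReal_mul (by positivity)]
  congr 1
  field_simp

/-- Bookkeeping of the scaling constants for `E` (`r⁻¹`-normalised, space–time weight
`(c² c³)⁻¹ c⁴`): `r⁻¹ · (c² c³)⁻¹ · c⁴ = (c r)⁻¹` in `ℝ≥0∞`. [folklore] -/
theorem scaleConst_one' (hc : 0 < c) (hr : 0 < r) :
    (ENNReal.ofReal r)⁻¹ * (ENNReal.ofReal (c ^ 2 * c ^ 3)⁻¹ * ENNReal.ofReal c ^ 4) =
      (ENNReal.ofReal (c * r))⁻¹ := by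
  rw [← ENNReal.ofReal_pow hc.le,
    ← ENNReal.ofReal_inv_of_pos hr, ← ENNReal.ofReal_inv_of_pos (by positivity : (0:ℝ) < c * r),
    ← ENNReal.ofReal_mul (by positivity), ← ENNReal.ofReal_mul (by positivity)]
  congr 1
  field_simp

/-- **Scale invariance of `C`**: `C(v_c; Q(z, r)) = C(v; Q(Φ z, c r))`. [folklore] -/
theorem cknC_nsZoom (hc : 0 < c) (hr : 0 < r) (t₀ : ℝ) (x₀ : ℝ³) (z : ℝ × ℝ³)
    (u : ℝ → ℝ³ → ℝ³) :
    cknC r z ((c • stPull (c ^ 2) c t₀ x₀ u)) = cknC (c * r) (stAffine (c ^ 2) c t₀ x₀ z) u := by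
  have hc2 : 0 < c ^ 2 := by positivity
  unfold cknC
  rw [← LocalTypeIScaling.stAffine_preimage_parabolicCylinder hc t₀ x₀ r z]
  have hF : (fun q : ℝ × ℝ³ => ‖(c • stPull (c ^ 2) c t₀ x₀ u) q.1 q.2‖ₑ ^ (3 : ℕ)) =
      fun q => (fun w : ℝ × ℝ³ => ENNReal.ofReal c ^ (3 : ℕ) * ‖u w.1 w.2‖ₑ ^ (3 : ℕ))
        (stAffine (c ^ 2) c t₀ x₀ q) := by
    funext q
    simp only [Pi.smul_apply, stPull_apply, stAffine_fst, stAffine_snd, enorm_smul, mul_pow,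
      Real.enorm_eq_ofReal hc.le]
  rw [show (∫⁻ q in stAffine (c ^ 2) c t₀ x₀ ⁻¹' parabolicCylinder (c * r) (stAffine (c ^ 2) c t₀ x₀ z),
      ‖(c • stPull (c ^ 2) c t₀ x₀ u) q.1 q.2‖ₑ ^ (3 : ℕ)) =
      ∫⁻ q in stAffine (c ^ 2) c t₀ x₀ ⁻¹' parabolicCylinder (c * r) (stAffine (c ^ 2) c t₀ x₀ z),
        (fun w : ℝ × ℝ³ => ENNReal.ofReal c ^ (3 : ℕ) * ‖u w.1 w.2‖ₑ ^ (3 : ℕ))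
          (stAffine (c ^ 2) c t₀ x₀ q) from by rw [hF]]
  rw [setLIntegral_preimage_comp_stAffine (E := ℝ³) hc2 hc t₀ x₀
      (fun w : ℝ × ℝ³ => ENNReal.ofReal c ^ (3 : ℕ) * ‖u w.1 w.2‖ₑ ^ (3 : ℕ))
      (parabolicCylinder (c * r) (stAffine (c ^ 2) c t₀ x₀ z)), finrank_euclideanSpace_fin,
    lintegral_const_mul' _ _ (by simp), ← mul_assoc (ENNReal.ofReal (c ^ 2 * c ^ 3)⁻¹),
    ← mul_assoc, scaleConst_sq hc hr]

/-- **Scale invariance of `E`**: `E(G_c; Q(z, r)) = E(G; Q(Φ z, c r))`. [folklore] -/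
theorem cknE_nsZoom (hc : 0 < c) (hr : 0 < r) (t₀ : ℝ) (x₀ : ℝ³) (z : ℝ × ℝ³)
    (G : ℝ → ℝ³ → ℝ³ →L[ℝ] ℝ³) :
    cknE r z ((c ^ 2 • stPull (c ^ 2) c t₀ x₀ G)) = cknE (c * r) (stAffine (c ^ 2) c t₀ x₀ z) G := by
  have hc2 : 0 < c ^ 2 := by positivity
  unfold cknE
  rw [← LocalTypeIScaling.stAffine_preimage_parabolicCylinder hc t₀ x₀ r z]
  have hF : (fun q : ℝ × ℝ³ => ENNReal.ofReal (frobeniusNormSq ((c ^ 2 • stPull (c ^ 2) c t₀ x₀ G) q.1 q.2))) =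
      fun q => (fun w : ℝ × ℝ³ => ENNReal.ofReal c ^ (4 : ℕ) *
        ENNReal.ofReal (frobeniusNormSq (G w.1 w.2))) (stAffine (c ^ 2) c t₀ x₀ q) := by
    funext q
    simp only [Pi.smul_apply, stPull_apply, stAffine_fst, stAffine_snd, frobeniusNormSq_smul]
    rw [ENNReal.ofReal_mul (by positivity), ← ENNReal.ofReal_pow hc.le]
    congr 2
    ring
  rw [show (∫⁻ q in stAffine (c ^ 2) c t₀ x₀ ⁻¹' parabolicCylinder (c * r) (stAffine (c ^ 2) c t₀ x₀ z),
      ENNReal.ofReal (frobeniusNormSq ((c ^ 2 • stPull (c ^ 2) c t₀ x₀ G) q.1 q.2))) =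
      ∫⁻ q in stAffine (c ^ 2) c t₀ x₀ ⁻¹' parabolicCylinder (c * r) (stAffine (c ^ 2) c t₀ x₀ z),
        (fun w : ℝ × ℝ³ => ENNReal.ofReal c ^ (4 : ℕ) *
          ENNReal.ofReal (frobeniusNormSq (G w.1 w.2))) (stAffine (c ^ 2) c t₀ x₀ q) from by rw [hF]]
  rw [setLIntegral_preimage_comp_stAffine (E := ℝ³) hc2 hc t₀ x₀
      (fun w : ℝ × ℝ³ => ENNReal.ofReal c ^ (4 : ℕ) * ENNReal.ofReal (frobeniusNormSq (G w.1 w.2)))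
      (parabolicCylinder (c * r) (stAffine (c ^ 2) c t₀ x₀ z)), finrank_euclideanSpace_fin,
    lintegral_const_mul' _ _ (by simp), ← mul_assoc (ENNReal.ofReal (c ^ 2 * c ^ 3)⁻¹),
    ← mul_assoc, scaleConst_one' hc hr]

/-- Preimage of the ball `B(x₀ + c y, c r)` under `x ↦ x₀ + c x` is `B(y, r)`. [folklore] -/
theorem space_affine_preimage_ball_zoom (hc : 0 < c) (x₀ y : ℝ³) (r : ℝ) :
    (fun x : ℝ³ => x₀ + c • x) ⁻¹' ball (x₀ + c • y) (c * r) = ball y r := by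
  rw [space_affine_preimage_ball hc]
  congr 1
  · rw [add_sub_cancel_left, smul_smul, inv_mul_cancel₀ hc.ne', one_smul]
  · field_simp

/-- Scaling of the spatial `L²`-mass at a fixed time: `r⁻¹ ∫_{B(y,r)} |c v(τ, x₀ + c x)|² dx =
(c r)⁻¹ ∫_{B(x₀ + c y, c r)} |v(τ, x)|² dx`. [folklore] -/
theorem scaledL2_nsZoom (hc : 0 < c) (hr : 0 < r) (x₀ y : ℝ³) (w : ℝ³ → ℝ³) :
    (ENNReal.ofReal r)⁻¹ * ∫⁻ x in ball y r, ‖c • w (x₀ + c • x)‖ₑ ^ 2 =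
      (ENNReal.ofReal (c * r))⁻¹ * ∫⁻ x in ball (x₀ + c • y) (c * r), ‖w x‖ₑ ^ 2 := by
  rw [← space_affine_preimage_ball_zoom hc x₀ y r]
  have hF : (fun x : ℝ³ => ‖c • w (x₀ + c • x)‖ₑ ^ 2) =
      fun x => (fun x' : ℝ³ => ENNReal.ofReal c ^ 2 * ‖w x'‖ₑ ^ 2) (x₀ + c • x) := by
    funext x
    simp only [enorm_smul, mul_pow, Real.enorm_eq_ofReal hc.le]
  rw [show (∫⁻ x in (fun x : ℝ³ => x₀ + c • x) ⁻¹' ball (x₀ + c • y) (c * r), ‖c • w (x₀ + c • x)‖ₑ ^ 2) =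
      ∫⁻ x in (fun x : ℝ³ => x₀ + c • x) ⁻¹' ball (x₀ + c • y) (c * r),
        (fun x' : ℝ³ => ENNReal.ofReal c ^ 2 * ‖w x'‖ₑ ^ 2) (x₀ + c • x) from by rw [hF]]
  rw [setLIntegral_preimage_comp_space_affine (E := ℝ³) hc x₀
      (fun x' : ℝ³ => ENNReal.ofReal c ^ 2 * ‖w x'‖ₑ ^ 2) (ball (x₀ + c • y) (c * r)), finrank_euclideanSpace_fin,
    lintegral_const_mul' _ _ (by simp), ← mul_assoc (ENNReal.ofReal (c ^ 3)⁻¹), ← mul_assoc,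
    scaleConst_one hc hr]

/-- The time-affine map `s ↦ t₀ + β s` (`β > 0`) pushes Lebesgue measure to `β⁻¹ • volume`. [folklore] -/
theorem map_time_affine_volume {β : ℝ} (hβ : 0 < β) (t₀ : ℝ) :
    Measure.map (fun s : ℝ => t₀ + β * s) (volume : Measure ℝ) = ENNReal.ofReal β⁻¹ • volume := by
  have h1 : (fun s : ℝ => t₀ + β * s) = (fun y => t₀ + y) ∘ fun s => β * s := rfl
  rw [h1, ← Measure.map_map (measurable_const_add t₀) (measurable_const_mul β),
    Real.map_volume_mul_left hβ.ne', Measure.map_smul, map_add_left_eq_self,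
    abs_of_pos (inv_pos.2 hβ)]

/-- The time-affine map is a measurable embedding. [folklore] -/
theorem measurableEmbedding_time_affine {β : ℝ} (hβ : β ≠ 0) (t₀ : ℝ) :
    MeasurableEmbedding (fun s : ℝ => t₀ + β * s) := by
  have : (fun s : ℝ => t₀ + β * s) = (Homeomorph.addLeft t₀) ∘ (Homeomorph.mulLeft₀ β hβ) := by
    funext s; rfl
  rw [this]
  exact (Homeomorph.addLeft t₀).measurableEmbedding.comp (Homeomorph.mulLeft₀ β hβ).measurableEmbedding

/-- Preimage of the time interval `(t₀ + β a, t₀ + β b)` under `s ↦ t₀ + β s` (`β > 0`). [folklore] -/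
theorem time_affine_preimage_Ioo {β : ℝ} (hβ : 0 < β) (t₀ a b : ℝ) :
    (fun s : ℝ => t₀ + β * s) ⁻¹' Ioo (t₀ + β * a) (t₀ + β * b) = Ioo a b := by
  ext s
  simp only [mem_preimage, mem_Ioo, add_lt_add_iff_left, mul_lt_mul_iff_right₀ hβ]

/-- **Transport of essential suprema in time**: `esssup_{s ∈ (a,b)} g(t₀ + β s) =
esssup_{t ∈ (t₀ + βa, t₀ + βb)} g(t)` (`β > 0`), for `ℝ≥0∞`-valued `g`. [folklore] -/
theorem essSup_comp_time_affine {β : ℝ} (hβ : 0 < β) (t₀ a b : ℝ) (g : ℝ → ℝ≥0∞) :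
    essSup (fun s => g (t₀ + β * s)) (volume.restrict (Ioo a b)) =
      essSup g (volume.restrict (Ioo (t₀ + β * a) (t₀ + β * b))) := by
  have hme := measurableEmbedding_time_affine hβ.ne' t₀
  have h1 := hme.restrict_map (volume : Measure ℝ) (Ioo (t₀ + β * a) (t₀ + β * b))
  rw [time_affine_preimage_Ioo hβ, map_time_affine_volume hβ, Measure.restrict_smul] at h1
  have h2 := hme.essSup_map_measure (μ := volume.restrict (Ioo a b)) (g := g)
  rw [← h1, essSup_ennreal_smul_measure (by simp [hβ]) g, Function.comp_def] at h2
  exact h2.symm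

/-- **Scale invariance of `A`** (essential-supremum form): `A(v_c; Q(z, r)) = A(v; Q(Φ z, c r))`.
[folklore] -/
theorem cknAEss_nsZoom (hc : 0 < c) (hr : 0 < r) (t₀ : ℝ) (x₀ : ℝ³) (z : ℝ × ℝ³)
    (u : ℝ → ℝ³ → ℝ³) :
    cknAEss r z ((c • stPull (c ^ 2) c t₀ x₀ u)) = cknAEss (c * r) (stAffine (c ^ 2) c t₀ x₀ z) u := by
  have hc2 : 0 < c ^ 2 := by positivity
  unfold cknAEss
  have hg : (fun t : ℝ => (ENNReal.ofReal r)⁻¹ *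
      ∫⁻ x in ball z.2 r, ‖(c • stPull (c ^ 2) c t₀ x₀ u) t x‖ₑ ^ 2) =
      fun t => (fun τ => (ENNReal.ofReal (c * r))⁻¹ *
        ∫⁻ x in ball (x₀ + c • z.2) (c * r), ‖u τ x‖ₑ ^ 2) (t₀ + c ^ 2 * t) := by
    funext t
    simp only [Pi.smul_apply, stPull_apply]
    exact scaledL2_nsZoom hc hr x₀ z.2 (u (t₀ + c ^ 2 * t))
  rw [hg, essSup_comp_time_affine hc2 t₀ (z.1 - r ^ 2) z.1
      (fun τ => (ENNReal.ofReal (c * r))⁻¹ * ∫⁻ x in ball (x₀ + c • z.2) (c * r), ‖u τ x‖ₑ ^ 2),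
    stAffine_fst, stAffine_snd]
  have h3 : t₀ + c ^ 2 * (z.1 - r ^ 2) = t₀ + c ^ 2 * z.1 - (c * r) ^ 2 := by ring
  rw [h3]

/-- The Lebesgue measure of preimages under the space zoom: `vol(A⁻¹ S) = (c³)⁻¹ vol(S)`,
`A y = x₀ + c y`. [folklore] -/
theorem volume_preimage_space_affine (hc : 0 < c) (x₀ : ℝ³) {S : Set ℝ³} (hS : MeasurableSet S) :
    volume ((fun y : ℝ³ => x₀ + c • y) ⁻¹' S) = ENNReal.ofReal (c ^ 3)⁻¹ * volume S := by
  have hA : Measurable (fun y : ℝ³ => x₀ + c • y) := by fun_prop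
  rw [← Measure.map_apply hA hS, map_space_affine_volume hc, finrank_euclideanSpace_fin, Measure.smul_apply,
    smul_eq_mul]

/-- **Averages over balls are zoom invariant**: `⨍_{B(y₀, r)} f(x₀ + c y) dy =
⨍_{B(x₀ + c y₀, c r)} f(x) dx` (`c > 0`). [folklore] -/
theorem setAverage_ball_comp_space_affine (hc : 0 < c) (x₀ y₀ : ℝ³) (r : ℝ) (f : ℝ³ → ℝ) :
    ⨍ y in ball y₀ r, f (x₀ + c • y) = ⨍ x in ball (x₀ + c • y₀) (c * r), f x := by
  have hc3 : (0 : ℝ) < c ^ 3 := by positivity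
  rw [setAverage_eq, setAverage_eq, ← space_affine_preimage_ball_zoom hc x₀ y₀ r]
  have hme := (spaceAffineHomeomorph hc.ne' x₀).measurableEmbedding
  have h1 := hme.setIntegral_map (μ := (volume : Measure ℝ³)) f (ball (x₀ + c • y₀) (c * r))
  rw [coe_spaceAffineHomeomorph] at h1
  rw [← h1, map_space_affine_volume hc, Measure.restrict_smul, integral_smul_measure,
    ENNReal.toReal_ofReal (by positivity), finrank_euclideanSpace_fin, measureReal_def,
    volume_preimage_space_affine hc x₀ measurableSet_ball, ENNReal.toReal_mul,
    ENNReal.toReal_ofReal (by positivity), ← measureReal_def, smul_smul, mul_inv, inv_inv]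
  congr 1
  field_simp

/-- `(c²)^{3/2} = c³` for `c ≥ 0`. [folklore] -/
theorem sq_rpow_threeHalves {c : ℝ} (hc : 0 ≤ c) : (c ^ 2) ^ ((3 : ℝ) / 2) = c ^ 3 := by
  rw [← Real.rpow_natCast c 2, ← Real.rpow_mul hc]
  norm_num

/-- **Scale invariance of `D`** (mean-free pressure): `D(q_c; Q(z, r)) = D(q; Q(Φ z, c r))`.
[folklore] -/
theorem cknDOsc_nsZoom (hc : 0 < c) (hr : 0 < r) (t₀ : ℝ) (x₀ : ℝ³) (z : ℝ × ℝ³)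
    (q : ℝ → ℝ³ → ℝ) :
    cknDOsc r z ((c ^ 2 • stPull (c ^ 2) c t₀ x₀ q)) = cknDOsc (c * r) (stAffine (c ^ 2) c t₀ x₀ z) q := by
  have hc2 : 0 < c ^ 2 := by positivity
  unfold cknDOsc
  rw [← LocalTypeIScaling.stAffine_preimage_parabolicCylinder hc t₀ x₀ r z]
  -- the zoomed mean
  have hmean : ∀ s : ℝ, ⨍ y in ball z.2 r, (c ^ 2 • stPull (c ^ 2) c t₀ x₀ q) s y =
      c ^ 2 * ⨍ x in ball (x₀ + c • z.2) (c * r), q (t₀ + c ^ 2 * s) x := by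
    intro s
    simp only [Pi.smul_apply, stPull_apply, smul_eq_mul]
    rw [← setAverage_ball_comp_space_affine hc x₀ z.2 r (q (t₀ + c ^ 2 * s)), average_eq',
      average_eq', integral_const_mul]
  have hF : (fun w : ℝ × ℝ³ => ‖(c ^ 2 • stPull (c ^ 2) c t₀ x₀ q) w.1 w.2 -
      ⨍ y in ball z.2 r, (c ^ 2 • stPull (c ^ 2) c t₀ x₀ q) w.1 y‖ₑ ^ (3 / 2 : ℝ)) =
      fun w => (fun w' : ℝ × ℝ³ => ENNReal.ofReal c ^ (3 : ℕ) *
        ‖q w'.1 w'.2 - ⨍ x in ball (x₀ + c • z.2) (c * r), q w'.1 x‖ₑ ^ (3 / 2 : ℝ))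
          (stAffine (c ^ 2) c t₀ x₀ w) := by
    funext w
    rw [hmean w.1]
    simp only [Pi.smul_apply, stPull_apply, smul_eq_mul, stAffine_fst, stAffine_snd]
    rw [← mul_sub, enorm_mul, ENNReal.mul_rpow_of_nonneg _ _ (by norm_num : (0:ℝ) ≤ 3 / 2),
      Real.enorm_eq_ofReal hc2.le, ENNReal.ofReal_rpow_of_nonneg hc2.le (by norm_num),
      sq_rpow_threeHalves hc.le, ENNReal.ofReal_pow hc.le]
  rw [show (∫⁻ w in stAffine (c ^ 2) c t₀ x₀ ⁻¹' parabolicCylinder (c * r) (stAffine (c ^ 2) c t₀ x₀ z),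
      ‖(c ^ 2 • stPull (c ^ 2) c t₀ x₀ q) w.1 w.2 -
        ⨍ y in ball z.2 r, (c ^ 2 • stPull (c ^ 2) c t₀ x₀ q) w.1 y‖ₑ ^ (3 / 2 : ℝ)) =
      ∫⁻ w in stAffine (c ^ 2) c t₀ x₀ ⁻¹' parabolicCylinder (c * r) (stAffine (c ^ 2) c t₀ x₀ z),
        (fun w' : ℝ × ℝ³ => ENNReal.ofReal c ^ (3 : ℕ) *
          ‖q w'.1 w'.2 - ⨍ x in ball (x₀ + c • z.2) (c * r), q w'.1 x‖ₑ ^ (3 / 2 : ℝ))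
            (stAffine (c ^ 2) c t₀ x₀ w) from by rw [hF]]
  rw [setLIntegral_preimage_comp_stAffine (E := ℝ³) hc2 hc t₀ x₀
      (fun w' : ℝ × ℝ³ => ENNReal.ofReal c ^ (3 : ℕ) *
        ‖q w'.1 w'.2 - ⨍ x in ball (x₀ + c • z.2) (c * r), q w'.1 x‖ₑ ^ (3 / 2 : ℝ))
      (parabolicCylinder (c * r) (stAffine (c ^ 2) c t₀ x₀ z)), finrank_euclideanSpace_fin,
    lintegral_const_mul' _ _ (by simp), ← mul_assoc (ENNReal.ofReal (c ^ 2 * c ^ 3)⁻¹),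
    ← mul_assoc, scaleConst_sq hc hr, stAffine_snd]

/-- **Scale invariance of `A + C + D + E`**: the A–B quantity of the zoomed triple on `Q(z, r)`
equals that of the original triple on `Q(Φ z, c r)`. [folklore] -/
theorem abScaledSum_nsZoom (hc : 0 < c) (hr : 0 < r) (t₀ : ℝ) (x₀ : ℝ³) (z : ℝ × ℝ³)
    (u : ℝ → ℝ³ → ℝ³) (q : ℝ → ℝ³ → ℝ) (G : ℝ → ℝ³ → ℝ³ →L[ℝ] ℝ³) :
    abScaledSum r z ((c • stPull (c ^ 2) c t₀ x₀ u)) ((c ^ 2 • stPull (c ^ 2) c t₀ x₀ q)) ((c ^ 2 • stPull (c ^ 2) c t₀ x₀ G)) =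
      abScaledSum (c * r) (stAffine (c ^ 2) c t₀ x₀ z) u q G := by
  simp only [abScaledSum, cknAEss_nsZoom hc hr, cknC_nsZoom hc hr, cknDOsc_nsZoom hc hr,
    cknE_nsZoom hc hr]

/-- **Scale invariance of `𝐈`**: `𝐈(Φ⁻¹ ω; v_c, q_c) = 𝐈(ω; v, q)` for the NS zoom about any
centre with any factor `c > 0` (A–B §3: "by translating in space-time and rescaling").
[folklore] -/
theorem typeIBound_nsZoom (hc : 0 < c) (t₀ : ℝ) (x₀ : ℝ³) (ω : Set (ℝ × ℝ³))
    (u : ℝ → ℝ³ → ℝ³) (q : ℝ → ℝ³ → ℝ) (G : ℝ → ℝ³ → ℝ³ →L[ℝ] ℝ³) :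
    typeIBound (stAffine (c ^ 2) c t₀ x₀ ⁻¹' ω) ((c • stPull (c ^ 2) c t₀ x₀ u)) ((c ^ 2 • stPull (c ^ 2) c t₀ x₀ q))
        ((c ^ 2 • stPull (c ^ 2) c t₀ x₀ G)) = typeIBound ω u q G := by
  have hsurj : Function.Surjective (stAffine (c ^ 2) c t₀ x₀) :=
    (stAffineHomeomorph (pow_ne_zero 2 hc.ne') hc.ne' t₀ x₀).surjective
  refine le_antisymm (typeIBound_le_iff.2 fun r hr z hz => ?_) (typeIBound_le_iff.2 fun R hR w hw => ?_)
  · rw [abScaledSum_nsZoom hc hr]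
    refine abScaledSum_le_typeIBound (mul_pos hc hr) fun w hw => ?_
    obtain ⟨w', rfl⟩ := hsurj w
    have hw' : w' ∈ parabolicCylinder r z := by
      rw [← LocalTypeIScaling.stAffine_preimage_parabolicCylinder hc t₀ x₀ r z]; exact hw
    exact hz hw'
  · obtain ⟨z, rfl⟩ := hsurj w
    have hR' : 0 < R / c := div_pos hR hc
    have hRc : R = c * (R / c) := by field_simp
    rw [hRc, ← abScaledSum_nsZoom hc hR']
    refine abScaledSum_le_typeIBound hR' ?_
    rw [← LocalTypeIScaling.stAffine_preimage_parabolicCylinder hc t₀ x₀ (R / c) z, ← hRc]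
    exact preimage_mono hw

/-- Zooming about the space–time origin maps the half space `ℝ³ × ℝ₋` (`Iio 0 ×ˢ univ`) onto
itself. [folklore] -/
theorem stAffine_preimage_lowerHalf (hc : 0 < c) :
    stAffine (c ^ 2) c 0 (0 : ℝ³) ⁻¹' (Iio (0 : ℝ) ×ˢ (univ : Set ℝ³)) = Iio (0 : ℝ) ×ˢ univ := by
  ext ⟨s, y⟩
  simp only [mem_preimage, stAffine_apply, mem_prod, mem_Iio, mem_univ, and_true, zero_add]
  constructor
  · intro h; nlinarith [sq_nonneg c, mul_pos (pow_pos hc 2) (show (0:ℝ) < 1 from one_pos)]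
  · intro h; nlinarith [pow_pos hc 2]

/-- **`𝐈` on `ℝ³ × ℝ₋` is invariant under the NS zoom about the origin** (used for
`v^{(k)}(x, t) = k v(k x, k² t)` in A–B §3). [folklore] -/
theorem typeIBound_lowerHalf_nsZoom (hc : 0 < c) (u : ℝ → ℝ³ → ℝ³) (q : ℝ → ℝ³ → ℝ)
    (G : ℝ → ℝ³ → ℝ³ →L[ℝ] ℝ³) :
    typeIBound (Iio (0 : ℝ) ×ˢ (univ : Set ℝ³)) ((c • stPull (c ^ 2) c 0 0 u)) ((c ^ 2 • stPull (c ^ 2) c 0 0 q))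
        ((c ^ 2 • stPull (c ^ 2) c 0 0 G)) = typeIBound (Iio (0 : ℝ) ×ˢ (univ : Set ℝ³)) u q G := by
  conv_lhs => rw [← stAffine_preimage_lowerHalf hc]
  exact typeIBound_nsZoom hc 0 0 _ u q G

/-- Zooming about the origin maps `Q(0, R)` onto `Q(0, R / c)`: preimage form. [folklore] -/
theorem stAffine_preimage_parabolicCylinder_zero (hc : 0 < c) (R : ℝ) :
    stAffine (c ^ 2) c 0 (0 : ℝ³) ⁻¹' parabolicCylinder R 0 = parabolicCylinder (R / c) 0 := by
  have h := LocalTypeIScaling.stAffine_preimage_parabolicCylinder hc 0 (0 : ℝ³) (R / c) 0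
  have h0 : stAffine (c ^ 2) c 0 (0 : ℝ³) 0 = 0 := by
    simp [stAffine, Prod.ext_iff]
  rwa [h0, mul_div_cancel₀ _ hc.ne'] at h

/-- **`L^∞` norms under the zoom**: `‖v_c‖_{L^∞(Q(z, r))} = c ‖v‖_{L^∞(Q(Φ z, c r))}`
(A–B §3: `‖v^{(k)}‖_{L^∞(Q(1/k))} = k N`). [folklore] -/
theorem eLpNorm_top_nsZoom (hc : 0 < c) (t₀ : ℝ) (x₀ : ℝ³) (r : ℝ) (z : ℝ × ℝ³)
    (u : ℝ → ℝ³ → ℝ³) :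
    eLpNorm (uncurry ((c • stPull (c ^ 2) c t₀ x₀ u))) ∞
        (volume.restrict (parabolicCylinder r z)) =
      ENNReal.ofReal c * eLpNorm (uncurry u) ∞
        (volume.restrict (parabolicCylinder (c * r) (stAffine (c ^ 2) c t₀ x₀ z))) := by
  have hc2 : 0 < c ^ 2 := by positivity
  have hme := measurableEmbedding_stAffine (E := ℝ³) hc2.ne' hc.ne' t₀ x₀
  set S := parabolicCylinder (c * r) (stAffine (c ^ 2) c t₀ x₀ z) with hS
  rw [eLpNorm_exponent_top, eLpNorm_exponent_top, eLpNormEssSup_eq_essSup_enorm,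
    eLpNormEssSup_eq_essSup_enorm, ← LocalTypeIScaling.stAffine_preimage_parabolicCylinder hc t₀ x₀ r z, ← hS]
  have hF : (fun w : ℝ × ℝ³ => ‖uncurry ((c • stPull (c ^ 2) c t₀ x₀ u)) w‖ₑ) =
      fun w => ENNReal.ofReal c * ((fun w' : ℝ × ℝ³ => ‖uncurry u w'‖ₑ) ∘ stAffine (c ^ 2) c t₀ x₀) w := by
    funext ⟨s, y⟩
    simp only [uncurry_apply_pair, Pi.smul_apply, stPull_apply, enorm_smul, Real.enorm_eq_ofReal hc.le,
      Function.comp_apply, stAffine_apply]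
  rw [hF, ENNReal.essSup_const_mul]
  congr 1
  have h2 := hme.essSup_map_measure (μ := volume.restrict (stAffine (c ^ 2) c t₀ x₀ ⁻¹' S))
    (g := fun w' : ℝ × ℝ³ => ‖uncurry u w'‖ₑ)
  rw [map_stAffine_volume_restrict_preimage hc2 hc, finrank_euclideanSpace_fin,
    essSup_ennreal_smul_measure (by simp; positivity)] at h2
  exact h2.symm

end Scaling

end Literature.Analysis.FluidPDE
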